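import Summits.HubbardSuperconductivity.HubbardLadder.Bounds.CoveringWordCount
import Literature.MathematicalPhysics.QuantumLattice.HubbardPolymerBounds
import Literature.MathematicalPhysics.QuantumLattice.HubbardCouplingWeights
import Literature.MathematicalPhysics.QuantumLattice.HubbardGapBounds
import Literature.Probability.LatticeModels.ClusterExpansionKPBound
import HarnessLib

/-!
# The Hölder-constant activity bound `|couplingWeight c K| ≤ ∏_{b∈K} (e^{|c_b|} - 1)`

HONEST FRAMING (cell pub-hubbard): ladder R1–R4 with certified numbers; no claim on H/H₀. Bounds for
model classes (activities of the polymer expansion of Hubbard-type lattice fermions with REAL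
on-site parameters and arbitrary complex bond couplings), no materials claim. Imports parts 1–2
(`TracePathExpansion`, `CoveringWordCount`) and the tree.

THEOREM (`norm_couplingWeight_le_prod_exp_sub_one`). For real `β, U, μ`, any complex couplings
`c` and any bond set `K`:  `|couplingWeight β U μ c K| ≤ ∏_{b ∈ K} (e^{|c_b|} - 1)`.

This is the constant of `bounds.tex` Lemma 12.2 (Hölder form; Ueltschi 1999 §2.3 obtains it from
the Duhamel expansion and Hölder's inequality for Schatten norms). The proof here is elementary:

1. EULER APPROXIMANTS. With `D = -β V = diagonal(d)` (real, occupation basis) and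
   `P_Y = Σ_{b∈Y} c_b T_b`, `F_N(Y) = Tr (e^{D/N}(1 + P_Y/N))^N → Tr e^{D + P_Y} = Zc(c·1_Y)` as
   `N → ∞` (`tendsto_euler_trotter`: the tree's Lie product formula
   `lieTrotter_productFormula_holds` plus `‖(e^{D/N}(1+P/N))^N - (e^{D/N}e^{P/N})^N‖ ≤ C/N` from the
   tree's `norm_pow_sub_pow_le'`, `norm_exp_sub_one_sub_le`, `norm_exp_le`).
2. DOMINATION AT FINITE `N` (`norm_alternatingSum_eulerTrace_le`, generic): expanding the `N`
   factors into words over the letters `e^{D/N}` and `e^{D/N} (c_b/N) T_b`, the signed sum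
   `Σ_{Y⊆K} (-1)^{|K∖Y|} F_N(Y)` keeps exactly the words using every bond of `K` (Möbius, tree
   lemma `sum_powerset_neg_one_pow_card_sdiff_ite_subset`); each word has `|Tr| ≤ Tr e^{D}` by the
   AM–GM word bound of part 1 (the hopping matrices `T_b` have at most one non-zero entry, of
   modulus `≤ 1`, per row: `absEntry_bondOp_mem_subStoch`), and the total coefficient weight is the
   covering-word count of part 2, `≤ ∏_{b∈K}(e^{|c_b|} - 1)`.
3. `couplingWeight = (Σ_Y (-1)^{|K∖Y|} Zc(c·1_Y)) / Zc(0)` and `Zc(0) = Tr e^{D} > 0`.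

References: D. Ueltschi, J. Stat. Phys. 95 (1999) 693, §2.3 [Ueltschi1999]; M. Reed, B. Simon,
Methods of Modern Mathematical Physics I, Thm VIII.29 [ReedSimonI1980] (product formula).
-/

namespace Summit.HubbardSuperconductivity.HubbardLadder.Bounds

open Matrix Finset Filter Topology
open Literature.MathematicalPhysics.QuantumLattice Literature.Probability.LatticeModels

/-! ### Domination at finite `N` (generic) -/

section Domination

variable {n : Type*} [Fintype n] [DecidableEq n] {α : Type*} [Fintype α] [DecidableEq α]

/-- Letters: the identity for `none`, the bond matrix `B b` for `some b`. -/
def letterMat (B : α → Matrix n n ℂ) : Option α → Matrix n n ℂ := fun a => a.elim 1 B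

/-- Unrestricted letter coefficients: `1` for `none`, `c_b / N` for `some b`. -/
noncomputable def letterCoef0 (c : α → ℂ) (N : ℕ) : Option α → ℂ := fun a => a.elim 1 fun b => (N : ℂ)⁻¹ * c b

/-- Letter coefficients restricted to the bond set `Y`. -/
noncomputable def letterCoef (c : α → ℂ) (N : ℕ) (Y : Finset α) : Option α → ℂ :=
  fun a => if a.toFinset ⊆ Y then letterCoef0 c N a else 0

omit [Fintype α] [DecidableEq α] in
/-- Entrywise absolute values of the letter matrices are substochastic. [this file] -/
theorem absEntry_letterMat_mem_subStoch {B : α → Matrix n n ℂ} (hB : ∀ b, absEntry (B b) ∈ subStoch)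
    (a : Option α) : absEntry (letterMat B a) ∈ subStoch := by
  cases a with
  | none => simp only [letterMat, Option.elim]; rw [absEntry_one]; exact one_mem_subStoch
  | some b => exact hB b

omit [Fintype α] [DecidableEq α] in
/-- Norm of the scalar coefficient of a letter. [this file] -/
theorem norm_letterCoef0 (c : α → ℂ) (N : ℕ) (a : Option α) :
    ‖letterCoef0 c N a‖ = letterWt (fun b => ‖c b‖ / N) a := by
  cases a with
  | none => simp [letterCoef0, letterWt]
  | some b => simp only [letterCoef0, letterWt, Option.elim, norm_mul, norm_inv,
      Complex.norm_natCast]; ring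

/-- The Euler factor as a sum over letters. [folklore] -/
theorem euler_factor_eq_sum (E : Matrix n n ℂ) (B : α → Matrix n n ℂ) (c : α → ℂ) (N : ℕ)
    (Y : Finset α) :
    E * (1 + (N : ℂ)⁻¹ • ∑ b ∈ Y, c b • B b) = ∑ a : Option α, letterCoef c N Y a • (E * letterMat B a) := by
  rw [Fintype.sum_option]
  simp only [letterCoef, letterCoef0, letterMat, Option.elim, Option.toFinset_none,
    Option.toFinset_some, Finset.empty_subset, if_true, one_smul, Matrix.mul_one,
    Finset.singleton_subset_iff, ite_smul, zero_smul, Finset.sum_ite_mem, Finset.univ_inter,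
    Matrix.mul_add, Matrix.mul_smul, Finset.mul_sum, Finset.smul_sum, smul_smul]

/-- The product of letter coefficients along a word, split by used bonds. [this file] -/
theorem prod_letterCoef_eq (c : α → ℂ) (N : ℕ) (Y : Finset α) {M : ℕ} (f : Fin M → Option α) :
    ∏ k, letterCoef c N Y (f k) = if usedSet f ⊆ Y then ∏ k, letterCoef0 c N (f k) else 0 := by
  have hiff : usedSet f ⊆ Y ↔ ∀ k, (f k).toFinset ⊆ Y := by
    constructor
    · intro h k b hb
      exact h (mem_usedSet.2 ⟨k, (Option.mem_toFinset.1 hb)⟩)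
    · intro h b hb
      obtain ⟨k, hk⟩ := mem_usedSet.1 hb
      exact h k (Option.mem_toFinset.2 (hk ▸ rfl))
  by_cases h : usedSet f ⊆ Y
  · rw [if_pos h]
    exact Finset.prod_congr rfl fun k _ => by rw [letterCoef, if_pos (hiff.1 h k)]
  · rw [if_neg h]
    obtain ⟨k, hk⟩ := not_forall.1 (mt hiff.2 h)
    exact Finset.prod_eq_zero (Finset.mem_univ k) (by rw [letterCoef, if_neg hk])

/-- **Domination at finite `N`.** For real `d`, `N ≥ 1`, bond matrices `B_b` with substochastic
moduli and complex `c`: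
`|Σ_{Y⊆K} (-1)^{|K∖Y|} Tr (diag(e^{d/N})(1 + N⁻¹ Σ_{b∈Y} c_b B_b))^N| ≤ ∏_{b∈K}(e^{|c_b|}-1) · Σ_s e^{d_s}`.
[folklore; this file] -/
theorem norm_alternatingSum_eulerTrace_le {N : ℕ} (hN : N ≠ 0) (d : n → ℝ)
    {B : α → Matrix n n ℂ} (hB : ∀ b, absEntry (B b) ∈ subStoch) (c : α → ℂ) (K : Finset α) :
    ‖∑ Y ∈ K.powerset, (-1 : ℂ) ^ (K \ Y).card *
        ((diagonal (fun s => (Real.exp (d s / N) : ℂ)) * (1 + (N : ℂ)⁻¹ • ∑ b ∈ Y, c b • B b)) ^ N).trace‖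
      ≤ (∏ b ∈ K, (Real.exp ‖c b‖ - 1)) * ∑ s, Real.exp (d s) := by
  set E : Matrix n n ℂ := diagonal (fun s => (Real.exp (d s / N) : ℂ)) with hE
  set W : (Fin N → Option α) → Matrix n n ℂ :=
    fun f => (List.ofFn fun k => E * letterMat B (f k)).prod with hW
  -- step 1: each trace as a sum over words
  have h1 : ∀ Y : Finset α, ((E * (1 + (N : ℂ)⁻¹ • ∑ b ∈ Y, c b • B b)) ^ N).trace =
      ∑ f : Fin N → Option α,
        (if usedSet f ⊆ Y then ∏ k, letterCoef0 c N (f k) else 0) * (W f).trace := by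
    intro Y
    rw [euler_factor_eq_sum, ← List.prod_replicate, ← List.ofFn_const,
      listProd_ofFn_sum_smul N (fun _ => letterCoef c N Y) (fun _ a => E * letterMat B a),
      Matrix.trace_sum]
    refine Finset.sum_congr rfl fun f _ => ?_
    rw [Matrix.trace_smul, smul_eq_mul, prod_letterCoef_eq]
  -- step 2: Möbius inversion keeps the covering words
  have h2 : ∑ Y ∈ K.powerset, (-1 : ℂ) ^ (K \ Y).card *
        ((E * (1 + (N : ℂ)⁻¹ • ∑ b ∈ Y, c b • B b)) ^ N).trace =
      ∑ f : Fin N → Option α,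
        (if usedSet f = K then (1 : ℂ) else 0) * ((∏ k, letterCoef0 c N (f k)) * (W f).trace) := by
    rw [Finset.sum_congr rfl fun Y _ => by rw [h1 Y, Finset.mul_sum], Finset.sum_comm]
    refine Finset.sum_congr rfl fun f _ => ?_
    rw [← sum_powerset_neg_one_pow_card_sdiff_ite_subset (usedSet f) K, Finset.sum_mul]
    refine Finset.sum_congr rfl fun Y _ => ?_
    split_ifs <;> ring
  rw [h2]
  -- step 3: norms
  have hZ : ∀ f : Fin N → Option α, ‖(W f).trace‖ ≤ ∑ s, Real.exp (d s) := fun f =>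
    norm_trace_listProd_diagExp_mul_le hN d (fun k => letterMat B (f k))
      fun k => absEntry_letterMat_mem_subStoch hB (f k)
  have hx0 : ∀ f : Fin N → Option α,
      ‖∏ k, letterCoef0 c N (f k)‖ = ∏ k, letterWt (fun b => ‖c b‖ / N) (f k) := fun f => by
    rw [norm_prod]
    exact Finset.prod_congr rfl fun k _ => norm_letterCoef0 c N (f k)
  have hy : ∀ b, 0 ≤ ‖c b‖ / N := fun b => by positivity
  have hZ0 : 0 ≤ ∑ s, Real.exp (d s) := Finset.sum_nonneg fun s _ => (Real.exp_pos _).le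
  calc ‖∑ f : Fin N → Option α,
          (if usedSet f = K then (1 : ℂ) else 0) * ((∏ k, letterCoef0 c N (f k)) * (W f).trace)‖
      ≤ ∑ f : Fin N → Option α,
          ‖(if usedSet f = K then (1 : ℂ) else 0) * ((∏ k, letterCoef0 c N (f k)) * (W f).trace)‖ :=
        norm_sum_le _ _
    _ ≤ ∑ f : Fin N → Option α,
          (if usedSet f = K then ∏ k, letterWt (fun b => ‖c b‖ / N) (f k) else 0) *
            ∑ s, Real.exp (d s) := by
        refine Finset.sum_le_sum fun f _ => ?_
        split_ifs with hf
        · rw [one_mul, norm_mul, hx0 f]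
          exact mul_le_mul_of_nonneg_left (hZ f) (Finset.prod_nonneg fun k _ => letterWt_nonneg hy _)
        · simp
    _ = coverSum (fun b => ‖c b‖ / N) N K * ∑ s, Real.exp (d s) := by rw [coverSum, Finset.sum_mul]
    _ ≤ (∏ b ∈ K, (Real.exp (N * (‖c b‖ / N)) - 1)) * ∑ s, Real.exp (d s) :=
        mul_le_mul_of_nonneg_right (coverSum_le hy N K) hZ0
    _ = (∏ b ∈ K, (Real.exp ‖c b‖ - 1)) * ∑ s, Real.exp (d s) := by
        congr 1
        refine Finset.prod_congr rfl fun b _ => ?_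
        rw [mul_div_cancel₀ _ (by exact_mod_cast hN : (N : ℝ) ≠ 0)]

end Domination

/-! ### The Euler–Trotter limit -/

section Limit

variable {n : Type*} [Fintype n] [DecidableEq n] [Nonempty n]

open NormedSpace in
open scoped Matrix.Norms.Operator in
/-- `‖(e^{D/N}(1 + P/N))^N - (e^{D/N} e^{P/N})^N‖ ≤ e^{2(‖D‖+‖P‖)} ‖P‖² / N` (`N ≥ 1`; the
`ℓ^∞`-operator norm). [folklore; Reed–Simon I, proof of Thm VIII.29] -/
theorem norm_euler_pow_sub_trotter_pow_le (Dm P : Matrix n n ℂ) {N : ℕ} (hN : N ≠ 0) :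
    ‖(exp ((N : ℂ)⁻¹ • Dm) * (1 + (N : ℂ)⁻¹ • P)) ^ N -
        (exp ((N : ℂ)⁻¹ • Dm) * exp ((N : ℂ)⁻¹ • P)) ^ N‖ ≤
      Real.exp (2 * (‖Dm‖ + ‖P‖)) * ‖P‖ ^ 2 / N := by
  obtain ⟨m, rfl⟩ := Nat.exists_eq_succ_of_ne_zero hN
  set a : Matrix n n ℂ := ((m + 1 : ℕ) : ℂ)⁻¹ • Dm with ha
  set b : Matrix n n ℂ := ((m + 1 : ℕ) : ℂ)⁻¹ • P with hb
  set S : ℝ := ‖Dm‖ + ‖P‖ with hS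
  have hm : (0 : ℝ) < (m + 1 : ℕ) := by positivity
  have hna : ‖a‖ = ‖Dm‖ / (m + 1 : ℕ) := by
    rw [ha, norm_smul, norm_inv, Complex.norm_natCast, div_eq_inv_mul]
  have hnb : ‖b‖ = ‖P‖ / (m + 1 : ℕ) := by
    rw [hb, norm_smul, norm_inv, Complex.norm_natCast, div_eq_inv_mul]
  have hS0 : 0 ≤ S := by positivity
  have hab : ‖a‖ + ‖b‖ = S / (m + 1 : ℕ) := by rw [hna, hnb, hS, add_div]
  set M : ℝ := Real.exp (S / (m + 1 : ℕ)) with hM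
  have hEa : ‖exp a‖ ≤ Real.exp ‖a‖ := norm_exp_le (𝕂 := ℂ) a
  have hEb : ‖exp b‖ ≤ Real.exp ‖b‖ := norm_exp_le (𝕂 := ℂ) b
  have hX : ‖exp a * (1 + b)‖ ≤ M := by
    refine (norm_mul_le _ _).trans ?_
    have h1 : ‖(1 : Matrix n n ℂ) + b‖ ≤ Real.exp ‖b‖ :=
      (norm_add_le _ _).trans (by rw [norm_one]; linarith [Real.add_one_le_exp ‖b‖])
    calc ‖exp a‖ * ‖1 + b‖ ≤ Real.exp ‖a‖ * Real.exp ‖b‖ :=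
          mul_le_mul hEa h1 (norm_nonneg _) (Real.exp_pos _).le
      _ = M := by rw [← Real.exp_add, hab]
  have hY : ‖exp a * exp b‖ ≤ M := by
    refine (norm_mul_le _ _).trans ?_
    calc ‖exp a‖ * ‖exp b‖ ≤ Real.exp ‖a‖ * Real.exp ‖b‖ :=
          mul_le_mul hEa hEb (norm_nonneg _) (Real.exp_pos _).le
      _ = M := by rw [← Real.exp_add, hab]
  have hXY : ‖exp a * (1 + b) - exp a * exp b‖ ≤ Real.exp S * (‖P‖ ^ 2 / (m + 1 : ℕ) ^ 2) := by
    rw [← mul_sub, show (1 : Matrix n n ℂ) + b - exp b = -(exp b - 1 - b) by abel, ]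
    refine (norm_mul_le _ _).trans ?_
    rw [norm_neg]
    have h2 := norm_exp_sub_one_sub_le (𝕂 := ℂ) b
    have ha' : ‖a‖ ≤ S := by
      rw [hna]; exact (div_le_self (norm_nonneg _) (by exact_mod_cast Nat.succ_pos m)).trans (by
        rw [hS]; linarith [norm_nonneg P])
    have hb' : ‖b‖ ≤ ‖P‖ := by rw [hnb]; exact div_le_self (norm_nonneg _) (by exact_mod_cast Nat.succ_pos m)
    calc ‖exp a‖ * ‖exp b - 1 - b‖ ≤ Real.exp ‖a‖ * (‖b‖ ^ 2 * Real.exp ‖b‖) :=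
          mul_le_mul hEa h2 (norm_nonneg _) (Real.exp_pos _).le
      _ ≤ Real.exp ‖Dm‖ * (‖b‖ ^ 2 * Real.exp ‖P‖) := by
          gcongr
          · rw [hna]; exact div_le_self (norm_nonneg _) (by exact_mod_cast Nat.succ_pos m)
      _ = Real.exp S * ‖b‖ ^ 2 := by rw [hS, Real.exp_add]; ring
      _ = Real.exp S * (‖P‖ ^ 2 / (m + 1 : ℕ) ^ 2) := by rw [hnb, div_pow]
  have hMm : M ^ m ≤ Real.exp S := by
    rw [hM, ← Real.exp_nat_mul, Real.exp_le_exp]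
    calc (m : ℝ) * (S / (m + 1 : ℕ)) = S * (m / (m + 1 : ℕ)) := by ring
      _ ≤ S * 1 := by
          refine mul_le_mul_of_nonneg_left ?_ hS0
          rw [div_le_one hm]; push_cast; linarith
      _ = S := mul_one S
  have key := norm_pow_sub_pow_le' _ _ hX hY m
  refine key.trans ?_
  have hM0 : 0 ≤ M ^ m := pow_nonneg (Real.exp_pos _).le m
  calc ((m : ℝ) + 1) * M ^ m * ‖exp a * (1 + b) - exp a * exp b‖
      ≤ ((m : ℝ) + 1) * Real.exp S * (Real.exp S * (‖P‖ ^ 2 / (m + 1 : ℕ) ^ 2)) := by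
        gcongr
    _ = Real.exp S * Real.exp S * ‖P‖ ^ 2 / (m + 1 : ℕ) := by
        push_cast
        field_simp
    _ = Real.exp (2 * (‖Dm‖ + ‖P‖)) * ‖P‖ ^ 2 / (m + 1 : ℕ) := by
        rw [← Real.exp_add, hS]
        ring_nf

open NormedSpace in
/-- **Euler–Trotter product formula**: `(e^{D/N}(1 + P/N))^N → e^{D+P}`. [folklore; from the
tree's Lie product formula `lieTrotter_productFormula_holds`] -/
theorem tendsto_euler_trotter (Dm P : Matrix n n ℂ) :
    Tendsto (fun N : ℕ => (exp ((N : ℂ)⁻¹ • Dm) * (1 + (N : ℂ)⁻¹ • P)) ^ N) atTop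
      (𝓝 (exp (Dm + P))) := by
  open scoped Matrix.Norms.Operator in
  have hT := lieTrotter_productFormula_holds (𝕜 := ℂ) (n := n) Dm P
  open scoped Matrix.Norms.Operator in
  have hdiff : Tendsto (fun N : ℕ => (exp ((N : ℂ)⁻¹ • Dm) * (1 + (N : ℂ)⁻¹ • P)) ^ N -
      (exp ((N : ℂ)⁻¹ • Dm) * exp ((N : ℂ)⁻¹ • P)) ^ N) atTop (𝓝 0) := by
    refine squeeze_zero_norm' ?_
      (tendsto_const_div_atTop_nhds_zero_nat (Real.exp (2 * (‖Dm‖ + ‖P‖)) * ‖P‖ ^ 2))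
    filter_upwards [eventually_ne_atTop 0] with N hN
    exact norm_euler_pow_sub_trotter_pow_le Dm P hN
  have h := hdiff.add hT
  simp only [sub_add_cancel, zero_add] at h
  exact h

open NormedSpace in
/-- Traces of the Euler approximants converge. [folklore] -/
theorem tendsto_trace_euler (Dm P : Matrix n n ℂ) :
    Tendsto (fun N : ℕ => ((exp ((N : ℂ)⁻¹ • Dm) * (1 + (N : ℂ)⁻¹ • P)) ^ N).trace) atTop
      (𝓝 (exp (Dm + P)).trace) :=
  ((continuous_id.matrix_trace).tendsto _).comp (tendsto_euler_trotter Dm P)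

end Limit

/-! ### Application to the Hubbard coupling weights -/

section Hubbard

variable {Λ : Type*} [LinearOrder Λ] [Fintype Λ]

/-- The hopping matrices `T_b = c†_{xσ} c_{yσ}` have at most one non-zero entry per row, of
modulus `≤ 1`: their moduli are substochastic. [cite: BratteliRobinsonII1997, §5.2.2] -/
theorem absEntry_bondOp_mem_subStoch (b : Bond Λ) : absEntry (bondOp b) ∈ subStoch := by
  refine mem_subStoch_iff.2 ⟨fun s t => norm_nonneg _, fun s => ?_⟩
  rw [Finset.sum_eq_single (hopBack b s)]
  · exact norm_bondOp_apply_le_one b s _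
  · intro t _ ht
    rw [absEntry_apply, norm_eq_zero]
    by_contra h
    exact ht (bondOp_apply_ne_zero h).2.2
  · intro h; exact absurd (Finset.mem_univ _) h

/-- The real diagonal of `-βV` for real parameters. -/
def negOnSiteDiagReal (β U μ : ℝ) (s : Finset (Orb Λ)) : ℝ :=
  -(onSiteDiag ((β : ℂ) * U) ((β : ℂ) * μ) (Finset.univ : Finset Λ) s).re

/-- `-β` times the on-site sum is a real diagonal matrix in the occupation basis. [this file] -/
theorem neg_smul_onSiteSum_eq_diagonal (β U μ : ℝ) :
    -((β : ℂ) • onSiteSum (U : ℂ) (μ : ℂ) (Finset.univ : Finset Λ)) =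
      diagonal fun s => ((negOnSiteDiagReal β U μ s : ℝ) : ℂ) := by
  rw [smul_onSiteSum_eq_diagonal, diagonal_neg]
  congr 1
  funext s
  simp only [negOnSiteDiagReal, Complex.ofReal_neg, neg_inj]
  rw [onSiteDiag_re]
  simp

/-- Exponential of `N⁻¹` times a real diagonal matrix. [this file] -/
theorem exp_inv_smul_diagonal_ofReal (d : Finset (Orb Λ) → ℝ) (N : ℕ) :
    NormedSpace.exp ((N : ℂ)⁻¹ • diagonal fun s => ((d s : ℝ) : ℂ)) =
      diagonal fun s => ((Real.exp (d s / N) : ℝ) : ℂ) := by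
  rw [← diagonal_smul, Matrix.exp_diagonal]
  congr 1
  funext s
  rw [Pi.exp_def, ← Complex.exp_eq_exp_ℂ, Complex.ofReal_exp]
  simp only [Pi.smul_apply, smul_eq_mul]
  push_cast
  ring

/-- The hopping sum of a restricted coupling. [this file] -/
theorem hopSum_couplingRestrict (c : Bond Λ → ℂ) (Y : Finset (Bond Λ)) :
    hopSum (couplingRestrict c Y) = ∑ b ∈ Y, c b • bondOp b := by
  unfold hopSum
  simp only [couplingRestrict_apply, ite_smul, zero_smul, Finset.sum_ite_mem, Finset.univ_inter]

/-- **THEOREM (the Hölder-constant activity bound, elementary proof).** For real `β, U, μ`, complex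
couplings `c` and a bond set `K`: `|couplingWeight β U μ c K| ≤ ∏_{b∈K} (e^{|c_b|} - 1)`.
[folklore: the constant of Ueltschi1999 §2.3 / bounds.tex Lemma 12.2 (Hölder form); this file] -/
theorem norm_couplingWeight_le_prod_exp_sub_one (β U μ : ℝ) (c : Bond Λ → ℂ) (K : Finset (Bond Λ)) :
    ‖couplingWeight (β : ℂ) (U : ℂ) (μ : ℂ) c K‖ ≤ ∏ b ∈ K, (Real.exp ‖c b‖ - 1) := by
  set d := negOnSiteDiagReal (Λ := Λ) β U μ with hd
  set Dm : Matrix (Finset (Orb Λ)) (Finset (Orb Λ)) ℂ := diagonal fun s => ((d s : ℝ) : ℂ) with hDm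
  have hD : -((β : ℂ) • onSiteSum (U : ℂ) (μ : ℂ) (Finset.univ : Finset Λ)) = Dm :=
    neg_smul_onSiteSum_eq_diagonal β U μ
  have hZc : ∀ c' : Bond Λ → ℂ, Zc (β : ℂ) (U : ℂ) (μ : ℂ) c' = (NormedSpace.exp (Dm + hopSum c')).trace := by
    intro c'; rw [Zc, hD]
  -- the Euler approximants of the alternating sum
  set ZD : ℝ := ∑ s, Real.exp (d s) with hZD
  have hZD0 : 0 < ZD := Finset.sum_pos (fun s _ => Real.exp_pos _) Finset.univ_nonempty
  set A : ℂ := ∑ Y ∈ K.powerset, (-1 : ℂ) ^ (K \ Y).card * Zc (β : ℂ) (U : ℂ) (μ : ℂ) (couplingRestrict c Y)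
    with hA
  have hlim : Tendsto (fun N : ℕ => ∑ Y ∈ K.powerset, (-1 : ℂ) ^ (K \ Y).card *
      ((diagonal (fun s => (Real.exp (d s / N) : ℂ)) *
        (1 + (N : ℂ)⁻¹ • ∑ b ∈ Y, c b • bondOp b)) ^ N).trace) atTop (𝓝 A) := by
    refine tendsto_finsetSum _ fun Y _ => Tendsto.const_mul _ ?_
    rw [hZc, hopSum_couplingRestrict]
    refine (tendsto_trace_euler Dm _).congr fun N => ?_
    rw [hDm, exp_inv_smul_diagonal_ofReal]
  have hbound : ‖A‖ ≤ (∏ b ∈ K, (Real.exp ‖c b‖ - 1)) * ZD := by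
    refine le_of_tendsto hlim.norm ?_
    filter_upwards [eventually_ne_atTop 0] with N hN
    exact norm_alternatingSum_eulerTrace_le hN d absEntry_bondOp_mem_subStoch c K
  -- `Zc 0 = ZD`
  have hZ0 : Zc (β : ℂ) (U : ℂ) (μ : ℂ) (0 : Bond Λ → ℂ) = (ZD : ℂ) := by
    rw [hZc, hopSum_zero, add_zero, hDm]
    have h := exp_inv_smul_diagonal_ofReal (Λ := Λ) d 1
    rw [Nat.cast_one, inv_one, one_smul] at h
    rw [h, trace_diagonal, hZD, Complex.ofReal_sum]
    simp
  -- assemble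
  have hcw : couplingWeight (β : ℂ) (U : ℂ) (μ : ℂ) c K = A / (ZD : ℂ) := by
    rw [couplingWeight_eq_sum, hA, Finset.sum_div]
    refine Finset.sum_congr rfl fun Y _ => ?_
    rw [gibbsRatio, hZ0, mul_div_assoc]
  rw [hcw, norm_div, Complex.norm_real, Real.norm_of_nonneg hZD0.le, div_le_iff₀ hZD0]
  exact hbound

end Hubbard

end Summit.HubbardSuperconductivity.HubbardLadder.Bounds
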